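import Literature.Probability.Percolation.TwoClusterGibbsCovariance
import HarnessLib

/-!
# Conjecture G / SET-W via a SET observer, VIII: BHK's two-step chain for a test function of BOTH clusters
# (the sum-level reduction behind Lemma T-set)

Support file (`--supports stmt-CriticalPhenomena-4576`); no named facts, no sorries; the two sum-level abbreviations `withinD₂`, `covD₂`
(two-argument versions of `BHK2006.withinD`, `BHK2006.covD`).  Seat (b) V⁺-form `png-dp-vplus`, gen 12 (memo MEMO-gen12.md §4(a), §10 (T) of
run/shared/lean/prim/prim-png-dp-vplus/).

In the set-observer conditioned slack hierarchy (…CSHSetDefs.lean) the observer slot tests the owner's cluster `C_S` through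
`h(C_S, C_T) = 1{O ∩ V(C_S) ≠ ∅}·1{O ∩ V(C_T) = ∅}`, a function of BOTH the owner's cluster and the avoided set's cluster, ANTITONE in
the second.  The Literature reduction `BHK2006.covD_nonneg_of_withinD_nonneg` (test functions of `C_S` only; law of total covariance along
`σ(C_T)`, BHK's two-step chain, Doeblin contraction) extends to such `h` with the identity `cov_D(φ,h) = P(D)·R(φ) + cov_D(𝑇φ, h)` replaced
by the INEQUALITY `cov_D(φ,h) ≥ P(D)·R(φ) + cov_D(𝑇φ, h)` for monotone `φ` (`covD₂_ge_withinD₂_add`): the only new step is Harris for the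
fresh `T`-half-step (`E[ψ(C_T') h(A, C_T')] ≥ E[ψ(C_T')]·E[h(A, C_T')]`, `ψ = E[φ(C_S) | C_T = ·]` and `h(A, ·)` both antitone).
* `covD₂_ge_withinD₂_add`, `covD₂_ge_sum_withinD₂_add` (telescoped), `covD₂_nonneg_of_withinD₂_nonneg` (**the reduction**: if the averaged
  one-step covariances `R(g) = E[Cov(g(C_S), h(C_S, C_T) | C_T); D]` are `≥ 0` for every monotone `g ≥ 0`, then `cov_D(f, h) ≥ 0` for every
  monotone `f`).
[cite: VandenbergHaggstromKahn2005, §2.1 pp. 9–13 (Lemmas 2.3–2.4, the chain, Claim 2.5, Remark 2.8) — corollaries]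
-/

noncomputable section

namespace Summit.CriticalPhenomena.PercolationContinuityZ3.Theorems

open MeasureTheory Set Literature.Probability.LatticeModels Literature.Probability.Percolation
open Literature.Probability.Percolation.BHK2006 Literature.Probability.Percolation.DecisionTree
open scoped Classical

namespace SetGibbs

variable {V : Type*} [Fintype V]

/-- **The averaged one-step covariance for a two-argument test function**:
`R₂(φ) = E[ Cov(φ(C_S), h(C_S, C_T) | C_T) 1_D ]` (denominator-free).
(transcription of the cell memo png-dp-vplus MEMO-gen12.md §10 (T)) [folklore] -/
def withinD₂ (w : Sym2 V → ℝ) (S T : Set V) (D : Set (Set (Sym2 V))) (φ : Set (Sym2 V) → ℝ)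
    (h : Set (Sym2 V) → Set (Sym2 V) → ℝ) : ℝ :=
  ∑ ω, weight w ω * ((condS w S T (fun A => φ A * h A (setCl ω T)) (setCl ω T) -
    condS w S T φ (setCl ω T) * condS w S T (fun A => h A (setCl ω T)) (setCl ω T)) * ind D ω)

/-- **Denominator-free conditional covariance on `D`** of `φ(C_S)` and `h(C_S, C_T)`.
(transcription of the cell memo png-dp-vplus MEMO-gen12.md §10 (T)) [folklore] -/
def covD₂ (w : Sym2 V → ℝ) (S T : Set V) (D : Set (Set (Sym2 V))) (φ : Set (Sym2 V) → ℝ)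
    (h : Set (Sym2 V) → Set (Sym2 V) → ℝ) : ℝ :=
  (∑ ω, weight w ω * ind D ω) * (∑ ω, weight w ω * (φ (setCl ω S) * h (setCl ω S) (setCl ω T) * ind D ω)) -
    (∑ ω, weight w ω * (φ (setCl ω S) * ind D ω)) * (∑ ω, weight w ω * (h (setCl ω S) (setCl ω T) * ind D ω))

/-- Harris for two ANTITONE functions of a product configuration (normalised weights): `E[f]E[g] ≤ E[fg]`. [folklore] -/
theorem harris_anti_anti {w : Sym2 V → ℝ} (hw0 : ∀ e, 0 ≤ w e) (hw1 : ∀ e, w e ≤ 1) (hm : ∑ ω, weight w ω = 1)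
    {f g : Set (Sym2 V) → ℝ} (hf : Antitone f) (hg : Antitone g) :
    (∑ η, weight w η * f η) * (∑ η, weight w η * g η) ≤ ∑ η, weight w η * (f η * g η) := by
  -- `f' = f(∅) − f ≥ 0` is monotone, `g` antitone bounded by `g(∅)`
  have key := harris_mono_anti hw0 hw1 hm (f := fun η => f ∅ - f η) (g := g)
    (fun η => sub_nonneg.2 (hf (empty_subset η))) (fun η η' h => sub_le_sub_left (hf h) _) hg (M := g ∅)
    (fun η => hg (empty_subset η))
  have e1 : ∑ η, weight w η * ((f ∅ - f η) * g η) = f ∅ * (∑ η, weight w η * g η) - ∑ η, weight w η * (f η * g η) := by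
    rw [Finset.mul_sum, ← Finset.sum_sub_distrib]; exact Finset.sum_congr rfl fun η _ => by ring
  have e2 : ∑ η, weight w η * (f ∅ - f η) = f ∅ - ∑ η, weight w η * f η := by
    rw [Finset.sum_congr rfl fun η _ => by rw [mul_sub], Finset.sum_sub_distrib, ← Finset.sum_mul, hm, one_mul]
  rw [e1, e2] at key
  nlinarith [key]

/-- **One-step covariance decomposition, two-argument test function (inequality).**  For `φ` monotone and `h(A, ·)` antitone for every
`A`:  `cov_D(φ, h) ≥ P(D)·R₂(φ) + cov_D(𝑇φ, h)`.
[cite: VandenbergHaggstromKahn2005, §2.1 Lemma 2.4 (p. 10), pp. 10–11, Remark 2.8 (p. 12) — corollary] -/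
theorem covD₂_ge_withinD₂_add (w : Sym2 V → ℝ) (hw0 : ∀ e, 0 ≤ w e) (hw1 : ∀ e, w e ≤ 1) (hm : ∑ ω, weight w ω = 1)
    (S T : Set V) {D : Set (Set (Sym2 V))} (hD : ∀ ω, ω ∈ D ↔ ∀ s ∈ S, ∀ t ∈ T, ¬ (openGraph ω).Reachable s t)
    {φ : Set (Sym2 V) → ℝ} (hφ : Monotone φ) {h : Set (Sym2 V) → Set (Sym2 V) → ℝ} (hh : ∀ A, Antitone (h A)) :
    (∑ ω, weight w ω * ind D ω) * withinD₂ w S T D φ h + covD₂ w S T D (gibbsT w S T φ) h ≤ covD₂ w S T D φ h := by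
  -- conditioning on `C_T`
  have e1 : ∑ ω, weight w ω * (φ (setCl ω S) * h (setCl ω S) (setCl ω T) * ind D ω) =
      ∑ ω, weight w ω * (condS w S T (fun A => φ A * h A (setCl ω T)) (setCl ω T) * ind D ω) :=
    set_sum_cond_cluster' w hm S T (fun A B => φ A * h A B) hD
  have e2 : ∑ ω, weight w ω * (φ (setCl ω S) * ind D ω) = ∑ ω, weight w ω * (condS w S T φ (setCl ω T) * ind D ω) :=
    set_sum_cond_cluster' w hm S T (fun A _ => φ A) hD
  have e3 : ∑ ω, weight w ω * (h (setCl ω S) (setCl ω T) * ind D ω) =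
      ∑ ω, weight w ω * (condS w S T (fun A => h A (setCl ω T)) (setCl ω T) * ind D ω) :=
    set_sum_cond_cluster' w hm S T (fun A B => h A B) hD
  have e5 : ∑ ω, weight w ω * (condS w S T φ (setCl ω T) * h (setCl ω S) (setCl ω T) * ind D ω) =
      ∑ ω, weight w ω * (condS w S T φ (setCl ω T) * condS w S T (fun A => h A (setCl ω T)) (setCl ω T) * ind D ω) := by
    rw [set_sum_cond_cluster' w hm S T (fun A B => condS w S T φ B * h A B) hD]
    refine Finset.sum_congr rfl fun ω _ => ?_
    congr 1
    congr 1
    have hc : condS w S T (fun A => h A (setCl ω T)) (setCl ω T) = ∑ η, weight w η * h (halfS S T (setCl ω T) η) (setCl ω T) := rfl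
    rw [hc, Finset.mul_sum]
    refine Finset.sum_congr rfl fun η _ => ?_
    simp only [halfS]
    ring
  have e6 : ∑ ω, weight w ω * (gibbsT w S T φ (setCl ω S) * ind D ω) = ∑ ω, weight w ω * (condS w S T φ (setCl ω T) * ind D ω) :=
    (set_sum_cond_cluster w hm S T (fun _ B => condS w S T φ B) hD).symm
  -- the `T`-half-step INEQUALITY (Harris in the fresh configuration)
  have e4 : ∑ ω, weight w ω * (gibbsT w S T φ (setCl ω S) * h (setCl ω S) (setCl ω T) * ind D ω) ≤
      ∑ ω, weight w ω * (condS w S T φ (setCl ω T) * h (setCl ω S) (setCl ω T) * ind D ω) := by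
    rw [set_sum_cond_cluster w hm S T (fun A B => gibbsT w S T φ A * h A B) hD,
      set_sum_cond_cluster w hm S T (fun A B => condS w S T φ B * h A B) hD]
    refine Finset.sum_le_sum fun ω _ => mul_le_mul_of_nonneg_left ?_ (weight_nonneg hw0 hw1 ω)
    refine mul_le_mul_of_nonneg_right ?_ (ind_nonneg D ω)
    set A := setCl ω S with hA
    have hgib : gibbsT w S T φ A = ∑ η, weight w η * condS w S T φ (halfT S T A η) := rfl
    have hlhs : ∑ η, weight w η * (gibbsT w S T φ A * h A (setCl (η \ barOf S A) T)) =
        gibbsT w S T φ A * ∑ η, weight w η * h A (halfT S T A η) := by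
      rw [Finset.mul_sum]; exact Finset.sum_congr rfl fun η _ => by simp only [halfT]; ring
    rw [hlhs, hgib]
    have hanti1 : Antitone fun η : Set (Sym2 V) => condS w S T φ (halfT S T A η) :=
      fun η η' hle => condS_antitone hw0 hw1 S T hφ (halfT_mono S T le_rfl hle)
    have hanti2 : Antitone fun η : Set (Sym2 V) => h A (halfT S T A η) :=
      fun η η' hle => hh A (halfT_mono S T le_rfl hle)
    have := harris_anti_anti hw0 hw1 hm hanti1 hanti2
    simpa only [halfT] using this
  have hmD0 : 0 ≤ ∑ ω, weight w ω * ind D ω := Finset.sum_nonneg fun ω _ => mul_nonneg (weight_nonneg hw0 hw1 ω) (ind_nonneg D ω)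
  have hW : withinD₂ w S T D φ h =
      (∑ ω, weight w ω * (condS w S T (fun A => φ A * h A (setCl ω T)) (setCl ω T) * ind D ω)) -
        ∑ ω, weight w ω * (condS w S T φ (setCl ω T) * condS w S T (fun A => h A (setCl ω T)) (setCl ω T) * ind D ω) := by
    rw [withinD₂, ← Finset.sum_sub_distrib]
    exact Finset.sum_congr rfl fun ω _ => by ring
  unfold covD₂
  rw [e1, e2, e3, e6, hW]
  have := mul_le_mul_of_nonneg_left e4 hmD0
  rw [e5] at this
  nlinarith [this]

/-- The iterates `𝑇ⁿ φ` of a monotone `φ` are monotone. [cite: VandenbergHaggstromKahn2005, §2.1 Remark 2.8 (p. 12)] -/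
theorem gibbsT_iterate_mono {w : Sym2 V → ℝ} (hw0 : ∀ e, 0 ≤ w e) (hw1 : ∀ e, w e ≤ 1) (S T : Set V)
    {φ : Set (Sym2 V) → ℝ} (hφ : Monotone φ) (n : ℕ) : Monotone ((gibbsT w S T)^[n] φ) := by
  induction n with
  | zero => exact hφ
  | succ m ihm => rw [Function.iterate_succ_apply']; exact gibbsT_mono hw0 hw1 S T ihm

/-- **Telescoped form (inequality)**: `cov_D(φ, h) ≥ P(D) Σ_{k<n} R₂(𝑇ᵏφ) + cov_D(𝑇ⁿφ, h)` for monotone `φ`.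
[cite: VandenbergHaggstromKahn2005, §2.1 pp. 10–11 — corollary] -/
theorem covD₂_ge_sum_withinD₂_add (w : Sym2 V → ℝ) (hw0 : ∀ e, 0 ≤ w e) (hw1 : ∀ e, w e ≤ 1) (hm : ∑ ω, weight w ω = 1)
    (S T : Set V) {D : Set (Set (Sym2 V))} (hD : ∀ ω, ω ∈ D ↔ ∀ s ∈ S, ∀ t ∈ T, ¬ (openGraph ω).Reachable s t)
    {φ : Set (Sym2 V) → ℝ} (hφ : Monotone φ) {h : Set (Sym2 V) → Set (Sym2 V) → ℝ} (hh : ∀ A, Antitone (h A)) (n : ℕ) :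
    (∑ ω, weight w ω * ind D ω) * ∑ k ∈ Finset.range n, withinD₂ w S T D ((gibbsT w S T)^[k] φ) h +
      covD₂ w S T D ((gibbsT w S T)^[n] φ) h ≤ covD₂ w S T D φ h := by
  induction n with
  | zero => simp
  | succ n ih =>
    have hmono : Monotone ((gibbsT w S T)^[n] φ) := gibbsT_iterate_mono hw0 hw1 S T hφ n
    have step := covD₂_ge_withinD₂_add w hw0 hw1 hm S T hD hmono hh
    rw [Finset.sum_range_succ, mul_add, Function.iterate_succ_apply']
    linarith [ih, step]

/-- `cov_D` (two-argument) is unchanged when a constant is subtracted from the first function. [folklore] -/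
theorem covD₂_sub_const (w : Sym2 V → ℝ) (S T : Set V) (D : Set (Set (Sym2 V))) (φ : Set (Sym2 V) → ℝ)
    (h : Set (Sym2 V) → Set (Sym2 V) → ℝ) (c : ℝ) :
    covD₂ w S T D (fun A => φ A - c) h = covD₂ w S T D φ h := by
  have h1 : ∀ ω : Set (Sym2 V), weight w ω * ((φ (setCl ω S) - c) * h (setCl ω S) (setCl ω T) * ind D ω) =
      weight w ω * (φ (setCl ω S) * h (setCl ω S) (setCl ω T) * ind D ω) -
        c * (weight w ω * (h (setCl ω S) (setCl ω T) * ind D ω)) := fun ω => by ring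
  have h2 : ∀ ω : Set (Sym2 V), weight w ω * ((φ (setCl ω S) - c) * ind D ω) =
      weight w ω * (φ (setCl ω S) * ind D ω) - c * (weight w ω * ind D ω) := fun ω => by ring
  simp only [covD₂, h1, h2, Finset.sum_sub_distrib, ← Finset.mul_sum]
  ring

/-- `|E[g 1_D]| ≤ c · P(D)` when `|g| ≤ c`. [folklore] -/
theorem abs_sum_ind_le {w : Sym2 V → ℝ} (hw0 : ∀ e, 0 ≤ w e) (hw1 : ∀ e, w e ≤ 1)
    (D : Set (Set (Sym2 V))) {g : Set (Sym2 V) → ℝ} {c : ℝ} (hg : ∀ ω, |g ω| ≤ c) :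
    |∑ ω, weight w ω * (g ω * ind D ω)| ≤ c * ∑ ω, weight w ω * ind D ω := by
  calc |∑ ω, weight w ω * (g ω * ind D ω)| ≤ ∑ ω, |weight w ω * (g ω * ind D ω)| := Finset.abs_sum_le_sum_abs _ _
    _ ≤ ∑ ω, c * (weight w ω * ind D ω) := Finset.sum_le_sum fun ω _ => by
        rw [abs_mul, abs_mul, abs_of_nonneg (weight_nonneg hw0 hw1 ω), abs_of_nonneg (ind_nonneg D ω)]
        calc weight w ω * (|g ω| * ind D ω) ≤ weight w ω * (c * ind D ω) :=
              mul_le_mul_of_nonneg_left (mul_le_mul_of_nonneg_right (hg ω) (ind_nonneg D ω)) (weight_nonneg hw0 hw1 ω)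
          _ = c * (weight w ω * ind D ω) := by ring
    _ = c * ∑ ω, weight w ω * ind D ω := by rw [Finset.mul_sum]

/-- **Small oscillation ⟹ small covariance** (two-argument): if `φ A − φ A' ≤ δ` and `|h| ≤ M` then `|cov_D(φ, h)| ≤ 2δM`. [folklore] -/
theorem abs_covD₂_le {w : Sym2 V → ℝ} (hw0 : ∀ e, 0 ≤ w e) (hw1 : ∀ e, w e ≤ 1) (hm : ∑ ω, weight w ω = 1)
    (S T : Set V) (D : Set (Set (Sym2 V))) {φ : Set (Sym2 V) → ℝ} {h : Set (Sym2 V) → Set (Sym2 V) → ℝ}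
    {δ M : ℝ} (hφ : ∀ A A', φ A - φ A' ≤ δ) (hM : ∀ A B, |h A B| ≤ M) :
    |covD₂ w S T D φ h| ≤ 2 * δ * M := by
  have hδ : 0 ≤ δ := by simpa using hφ ∅ ∅
  have hM0 : 0 ≤ M := (abs_nonneg _).trans (hM ∅ ∅)
  set mD : ℝ := ∑ ω, weight w ω * ind D ω with hmD
  have hmD0 : 0 ≤ mD := Finset.sum_nonneg fun ω _ => mul_nonneg (weight_nonneg hw0 hw1 ω) (ind_nonneg D ω)
  have hmD1 : mD ≤ 1 := by
    calc mD ≤ ∑ ω, weight w ω := Finset.sum_le_sum fun ω _ => by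
            simpa using mul_le_mul_of_nonneg_left (ind_le_one D ω) (weight_nonneg hw0 hw1 ω)
      _ = 1 := hm
  rw [← covD₂_sub_const w S T D φ h (φ ∅)]
  set ψ : Set (Sym2 V) → ℝ := fun A => φ A - φ ∅ with hψ
  have hψb : ∀ A, |ψ A| ≤ δ := fun A => abs_sub_le_iff.2 ⟨hφ A ∅, by linarith [hφ ∅ A]⟩
  have b1 : |∑ ω, weight w ω * (ψ (setCl ω S) * h (setCl ω S) (setCl ω T) * ind D ω)| ≤ δ * M * mD := by
    have := abs_sum_ind_le hw0 hw1 D (g := fun ω => ψ (setCl ω S) * h (setCl ω S) (setCl ω T)) (c := δ * M)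
      (fun ω => by rw [abs_mul]; exact mul_le_mul (hψb _) (hM _ _) (abs_nonneg _) hδ)
    simpa only [hmD] using this
  have b2 : |∑ ω, weight w ω * (ψ (setCl ω S) * ind D ω)| ≤ δ * mD :=
    abs_sum_ind_le hw0 hw1 D (g := fun ω => ψ (setCl ω S)) (fun ω => hψb _)
  have b3 : |∑ ω, weight w ω * (h (setCl ω S) (setCl ω T) * ind D ω)| ≤ M * mD :=
    abs_sum_ind_le hw0 hw1 D (g := fun ω => h (setCl ω S) (setCl ω T)) (fun ω => hM _ _)
  have hcov : covD₂ w S T D ψ h =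
      mD * (∑ ω, weight w ω * (ψ (setCl ω S) * h (setCl ω S) (setCl ω T) * ind D ω)) -
        (∑ ω, weight w ω * (ψ (setCl ω S) * ind D ω)) *
          (∑ ω, weight w ω * (h (setCl ω S) (setCl ω T) * ind D ω)) := rfl
  rw [hcov]
  have t1 : |mD * ∑ ω, weight w ω * (ψ (setCl ω S) * h (setCl ω S) (setCl ω T) * ind D ω)| ≤ δ * M := by
    rw [abs_mul, abs_of_nonneg hmD0]
    calc mD * |∑ ω, weight w ω * (ψ (setCl ω S) * h (setCl ω S) (setCl ω T) * ind D ω)| ≤ 1 * (δ * M * mD) :=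
          mul_le_mul hmD1 b1 (abs_nonneg _) zero_le_one
      _ ≤ δ * M := by rw [one_mul]; exact mul_le_of_le_one_right (mul_nonneg hδ hM0) hmD1
  have t2 : |(∑ ω, weight w ω * (ψ (setCl ω S) * ind D ω)) *
      (∑ ω, weight w ω * (h (setCl ω S) (setCl ω T) * ind D ω))| ≤ δ * M := by
    rw [abs_mul]
    calc |∑ ω, weight w ω * (ψ (setCl ω S) * ind D ω)| * |∑ ω, weight w ω * (h (setCl ω S) (setCl ω T) * ind D ω)|
        ≤ (δ * mD) * (M * mD) := mul_le_mul b2 b3 (abs_nonneg _) (by positivity)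
      _ ≤ δ * M := by nlinarith [mul_nonneg hδ hM0, mul_le_one₀ hmD1 hmD0 hmD1]
  calc |mD * (∑ ω, weight w ω * (ψ (setCl ω S) * h (setCl ω S) (setCl ω T) * ind D ω)) -
        (∑ ω, weight w ω * (ψ (setCl ω S) * ind D ω)) *
          (∑ ω, weight w ω * (h (setCl ω S) (setCl ω T) * ind D ω))|
      ≤ |mD * ∑ ω, weight w ω * (ψ (setCl ω S) * h (setCl ω S) (setCl ω T) * ind D ω)| +
          |(∑ ω, weight w ω * (ψ (setCl ω S) * ind D ω)) *
            (∑ ω, weight w ω * (h (setCl ω S) (setCl ω T) * ind D ω))| := abs_sub _ _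
    _ ≤ 2 * δ * M := by linarith

/-- `regenWeight w T ≤ 1`. [folklore] -/
theorem regenWeight_le_one {w : Sym2 V → ℝ} (hw0 : ∀ e, 0 ≤ w e) (hw1 : ∀ e, w e ≤ 1)
    (hm : ∑ ω, weight w ω = 1) (T : Set V) : regenWeight w T ≤ 1 := by
  calc regenWeight w T ≤ ∑ η, weight w η := Finset.sum_le_sum fun η _ => by
          simpa using mul_le_mul_of_nonneg_left (ind_le_one (regenT T) η) (weight_nonneg hw0 hw1 η)
    _ = 1 := hm

/-- **Reduction of a conditional covariance sign to the averaged one-step covariances — two-argument test function.**  Pair weights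
`w ∈ [0,1]`, positive regeneration weight of `T`, `D = {S ↮ T}`, `h(C_S, C_T)` antitone in `C_T`.  If
`R₂(g) = E[Cov(g(C_S), h(C_S, C_T) | C_T); D] ≥ 0` for every monotone nonnegative `g`, then `cov_D(f, h) ≥ 0` for every monotone `f`.
[cite: VandenbergHaggstromKahn2005, §2.1 pp. 10–13 (the chain, Claim 2.5, Remark 2.8) — corollary] -/
theorem covD₂_nonneg_of_withinD₂_nonneg {w : Sym2 V → ℝ} (hw0 : ∀ e, 0 ≤ w e) (hw1 : ∀ e, w e ≤ 1)
    (hm : ∑ ω, weight w ω = 1) (S T : Set V) {D : Set (Set (Sym2 V))}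
    (hD : ∀ ω, ω ∈ D ↔ ∀ s ∈ S, ∀ t ∈ T, ¬ (openGraph ω).Reachable s t)
    (hε : 0 < regenWeight w T) (h : Set (Sym2 V) → Set (Sym2 V) → ℝ) (hh : ∀ A, Antitone (h A))
    (hR : ∀ g : Set (Sym2 V) → ℝ, Monotone g → (∀ A, 0 ≤ g A) → 0 ≤ withinD₂ w S T D g h)
    {f : Set (Sym2 V) → ℝ} (hf : Monotone f) : 0 ≤ covD₂ w S T D f h := by
  set f₀ : Set (Sym2 V) → ℝ := fun A => f A - f ∅ with hf₀
  have hf₀m : Monotone f₀ := fun A A' hAA' => sub_le_sub_right (hf hAA') _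
  have hf₀0 : ∀ A, 0 ≤ f₀ A := fun A => sub_nonneg.2 (hf (empty_subset A))
  set c : ℝ := f univ - f ∅ with hc
  have hosc : ∀ A A', f₀ A - f₀ A' ≤ c := fun A A' => by
    simp only [hf₀, hc]
    linarith [hf (subset_univ A), hf (empty_subset A')]
  set M : ℝ := ∑ A : Set (Sym2 V), ∑ B : Set (Sym2 V), |h A B| with hMdef
  have hM : ∀ A B, |h A B| ≤ M := fun A B => by
    calc |h A B| ≤ ∑ B' : Set (Sym2 V), |h A B'| := Finset.single_le_sum (f := fun B' => |h A B'|) (fun _ _ => abs_nonneg _) (Finset.mem_univ B)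
      _ ≤ M := Finset.single_le_sum (f := fun A' => ∑ B' : Set (Sym2 V), |h A' B'|)
          (fun _ _ => Finset.sum_nonneg fun _ _ => abs_nonneg _) (Finset.mem_univ A)
  set mD : ℝ := ∑ ω, weight w ω * ind D ω with hmD
  have hmD0 : 0 ≤ mD := Finset.sum_nonneg fun ω _ => mul_nonneg (weight_nonneg hw0 hw1 ω) (ind_nonneg D ω)
  set ρ : ℝ := 1 - regenWeight w T with hρ
  have hρ0 : 0 ≤ ρ := sub_nonneg.2 (regenWeight_le_one hw0 hw1 hm T)
  have hρ1 : ρ < 1 := by simp only [hρ]; linarith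
  have key : ∀ n : ℕ, -(2 * (ρ ^ n * c) * M) ≤ covD₂ w S T D f₀ h := by
    intro n
    have htel := covD₂_ge_sum_withinD₂_add w hw0 hw1 hm S T hD hf₀m hh n
    have h1 : 0 ≤ mD * ∑ k ∈ Finset.range n, withinD₂ w S T D ((gibbsT w S T)^[k] f₀) h :=
      mul_nonneg hmD0 (Finset.sum_nonneg fun k _ =>
        hR _ (gibbsT_iterate_mono_nonneg hw0 hw1 S T hf₀m hf₀0 k).1 (gibbsT_iterate_mono_nonneg hw0 hw1 S T hf₀m hf₀0 k).2)
    have h2 : |covD₂ w S T D ((gibbsT w S T)^[n] f₀) h| ≤ 2 * (ρ ^ n * c) * M :=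
      abs_covD₂_le hw0 hw1 hm S T D (gibbsT_iterate_sub_le hw0 hw1 hm S T n hosc) hM
    linarith [neg_abs_le (covD₂ w S T D ((gibbsT w S T)^[n] f₀) h)]
  have hlim : Filter.Tendsto (fun n : ℕ => -(2 * (ρ ^ n * c) * M)) Filter.atTop (nhds 0) := by
    have h0 : Filter.Tendsto (fun n : ℕ => ρ ^ n) Filter.atTop (nhds 0) := tendsto_pow_atTop_nhds_zero_of_lt_one hρ0 hρ1
    have : Filter.Tendsto (fun n : ℕ => -(2 * (ρ ^ n * c) * M)) Filter.atTop (nhds (-(2 * (0 * c) * M))) :=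
      (((h0.mul_const c).const_mul 2).mul_const M).neg
    simpa using this
  have hge : 0 ≤ covD₂ w S T D f₀ h := le_of_tendsto' hlim key
  rwa [hf₀, covD₂_sub_const] at hge

end SetGibbs

end Summit.CriticalPhenomena.PercolationContinuityZ3.Theorems

end
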